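import Mathlib
import Summits.ValiantsHypothesis.ValiantsHypothesis.Theorems.LacunarySymmetroidMatrixDescartesChainSectorCore

/-!
# `MatrixDescartes` (stmt-ValiantsHypothesis-18050) — the LOEWNER SECTOR in normal form: a positively normalisable
# Loewner-monotone pencil has at most `m` positive zeros (ENGINE, no strictness needed), and the THREE-BLOCK family
# «negative semidefinite head | scaled Loewner chain | positive semidefinite tail» (K-free, `Z₊ ≤ m`)

HONEST FRAMING.  Cell `pub-symmetroid`, seat `val-sym-mdr-p2` (gen 4); helper file `--supports` the crux
`Theses.LacunarySymmetroid.MatrixDescartes`.  SECTOR theorems: they bound the positive zeros of structural classes of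
lacunary symmetric pencils and record the crux's inequality on the corresponding format family at every admissible
size; nothing here bears on the crux in general, on the line `Lift`'s open stub `stub_twoSided`, on `DoorA26` /
`DoorA34`, or on `VP ≠ VNP`.

§1 THE ENGINE (`LoewnerSector.posRoots_le_of_normalisation`).  Let `F = ∑ₗ X^{dₗ} Sₗ` have real symmetric `ι × ι`
letters and let `w : (0,∞) → (0,∞)` be ANY positive weight such that `u ↦ w(u)⁻¹·F(u)` is Loewner non-decreasing on
`(0,∞)`.  Then `det F` has at most `card ι` distinct positive zeros.  No strictness hypothesis is needed: at a positive
root `t₀` with kernel vector `v`, if `vᵀ(F(s)/w(s))v = 0` for some `s > t₀` then monotonicity pins the form to `0` on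
`[t₀, s]`, the positive semidefinite differences force `F(u)v = 0` there, so `det F` vanishes on an interval and is the
zero polynomial (`LoewnerSector.kernelData`); otherwise the tree's inertia chain (`stub_inertiaChain`) applies.  Every
K-free «one Loewner-monotone family» law of the tree is an instance by exhibiting `w`: the first rung / one-alternation
rule (`w = x^e`, [CameronPsarrakos2019, Lemma 6] for `α = 1`), the Loewner-chain sector (`w = ∑_{l≥p} x^{dₗ}`,
`…ChainSector`), and the three-block family below.

§2–§4 THE THREE-BLOCK LOEWNER SECTOR (`loewnerSector`).  Exponents listed increasingly (`d` strictly monotone), two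
indices `p ≤ r`, positive scalars `aₗ` on the CORE `p ≤ l ≤ r`: HEAD `l < p`: `Sₗ ⪯ 0`; CORE `p ≤ i ≤ j ≤ r`:
`aᵢ·Sⱼ − aⱼ·Sᵢ ⪰ 0`, i.e. `S_p/a_p ⪯ ⋯ ⪯ S_r/a_r` is a Loewner chain after POSITIVE RESCALING of the letters (the
letters themselves arbitrary symmetric); TAIL `l > r`: `Sₗ ⪰ 0`.  Then `Z₊ ≤ card ι` (weight `w = ∑_{p≤l≤r} aₗ x^{dₗ}`; the monotonicity of `F/w` is the Chebyshev-sum pairing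
`w(s)f(t) − w(t)f(s) = ∑_{head×core} + ∑_{tail×core} + ½∑_{core×core} aᵢaⱼ·w_{ij}(qⱼ/aⱼ − qᵢ/aᵢ)` with every summand
`≥ 0`, `LoewnerSector.key₃_nonneg`).  SPECIAL CASES: `p = r` (one-letter core) is the one-alternation rule
`oneAlternation_mirror` with a single pivot letter; `r = K−1`, `a ≡ 1` is `chainSector`; `p = 0`, `r = K−1` is the
SCALED CHAIN `∃ aₗ > 0, Sₗ/aₗ` non-decreasing — at `card ι = 1` exactly «at most one sign change», so the bound is
Descartes' and the family is the matrix form of V ≤ 1 in which the letters need not be semidefinite.  Crux currency: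
`loewnerWord_realRoots_le` (`≤ 2·card ι + 1` real zeros when `F(X)` and `F(−X)` are both three-block words),
`loewnerSector_mdr` (the inequality of `MatrixDescartes` on this format family at every admissible size).
presearch: as for `…ChainSector` (none beyond [CameronPsarrakos2019, Lemma 6]; the scalar pairing is the Chebyshev /
Biernacki–Krzyż monotone-ratio lemma for finite sums).  Elementary; Mathlib + tree lemmas (`stub_inertiaChain`,
`stub_negRoots`, `linearCount_absorbed`, `ChainSector.*`, `OneAlternation.*`); axioms `propext`, `Classical.choice`, `Quot.sound`. -/

-- layout Summits/ValiantsHypothesis/ValiantsHypothesis forces the duplicated namespace component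
set_option linter.dupNamespace false

namespace Summit.ValiantsHypothesis.ValiantsHypothesis.Theorems.LacunarySymmetroidMatrixDescartes

open Polynomial Matrix Finset
open scoped BigOperators

namespace LoewnerSector

variable {K : ℕ} {ι : Type*} [Fintype ι]

/-! ## §1 The engine: positively normalisable Loewner-monotone pencils -/

/-- Quadratic form of the normalised family: `vᵀ(c • F(u))v = c · ∑ₗ u^{dₗ}·vᵀSₗv`. [folklore] -/
theorem quadForm_smul_family (d : Fin K → ℕ) (S : Fin K → Matrix ι ι ℝ) (c u : ℝ) (v : ι → ℝ) :
    v ⬝ᵥ ((c • ∑ l, (u ^ d l) • S l) *ᵥ v) = c * ∑ l, u ^ d l * (v ⬝ᵥ (S l *ᵥ v)) := by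
  rw [Matrix.smul_mulVec, dotProduct_smul, smul_eq_mul, OneAlternation.dotProduct_family_mulVec]

omit [Fintype ι] in
/-- The evaluated pencil `∑ₗ u^{dₗ} Sₗ` is symmetric when the letters are, and so is any scalar multiple. [folklore] -/
theorem smul_family_isSymm (d : Fin K → ℕ) (S : Fin K → Matrix ι ι ℝ) (hS : ∀ l, (S l).IsSymm) (c u : ℝ) :
    (c • ∑ l, (u ^ d l) • S l).IsSymm := by
  have hsum : (∑ l, (u ^ d l) • S l).IsSymm := by
    unfold Matrix.IsSymm
    rw [Matrix.transpose_sum]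
    exact Finset.sum_congr rfl fun l _ => by rw [Matrix.transpose_smul, (hS l).eq]
  exact hsum.smul _

/-- **Kernel data without strictness.**  Let `w > 0` on `(0,∞)` make `G(u) = w(u)⁻¹ • F(u)` Loewner non-decreasing
on `(0,∞)`, `F = ∑ₗ X^{dₗ} Sₗ` with `det F ≠ 0`.  At a positive root `t₀` of `det F` there is `v ≠ 0` with
`G(t₀)v = 0` and `vᵀG(s)v > 0` for all `s > t₀`: if the form vanished at `s`, it would vanish on `[t₀, s]`
(monotonicity), the positive semidefinite differences `G(u) − G(t₀)` would kill `v`, so `F(u)v = 0` and `det F(u) = 0`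
for every `u ∈ [t₀, s]` — infinitely many roots. [folklore] -/
theorem kernelData [DecidableEq ι] (d : Fin K → ℕ) (S : Fin K → Matrix ι ι ℝ) (w : ℝ → ℝ)
    (hw : ∀ u, 0 < u → 0 < w u)
    (hmono : ∀ s t : ℝ, 0 < s → s ≤ t →
      (((w t)⁻¹ • ∑ l, (t ^ d l) • S l) - ((w s)⁻¹ • ∑ l, (s ^ d l) • S l)).PosSemidef)
    (hdet : Matrix.det (∑ l, ((Polynomial.X : Polynomial ℝ) ^ d l) • (S l).map Polynomial.C) ≠ 0)
    (t₀ : ℝ) (ht₀ : 0 < t₀)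
    (hroot : (Matrix.det (∑ l, ((Polynomial.X : Polynomial ℝ) ^ d l) •
      (S l).map Polynomial.C)).IsRoot t₀) :
    ∃ v : ι → ℝ, v ≠ 0 ∧ ((w t₀)⁻¹ • ∑ l, (t₀ ^ d l) • S l) *ᵥ v = 0 ∧
      ∀ s : ℝ, t₀ < s → 0 < v ⬝ᵥ (((w s)⁻¹ • ∑ l, (s ^ d l) • S l) *ᵥ v) := by
  -- a nonzero kernel vector of `F(t₀)`
  have hdet0 : (∑ l, (t₀ ^ d l) • S l).det = 0 := by
    have h1 : (Matrix.det (∑ l, ((Polynomial.X : Polynomial ℝ) ^ d l) •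
        (S l).map Polynomial.C)).eval t₀ = 0 := hroot
    rwa [ChainSector.eval_det_pencil d S t₀] at h1
  obtain ⟨v, hv, hFv⟩ := Matrix.exists_mulVec_eq_zero_iff.2 hdet0
  have hGv : ((w t₀)⁻¹ • ∑ l, (t₀ ^ d l) • S l) *ᵥ v = 0 := by
    rw [Matrix.smul_mulVec, hFv, smul_zero]
  refine ⟨v, hv, hGv, fun s hs => ?_⟩
  -- the form at `s` is `≥ 0` by monotonicity from `t₀`
  have hform_nonneg : ∀ u, t₀ ≤ u → 0 ≤ v ⬝ᵥ (((w u)⁻¹ • ∑ l, (u ^ d l) • S l) *ᵥ v) := by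
    intro u hu
    have h := (hmono t₀ u ht₀ hu).dotProduct_mulVec_nonneg v
    rwa [star_trivial, Matrix.sub_mulVec, dotProduct_sub, hGv, dotProduct_zero, sub_zero] at h
  refine (hform_nonneg s hs.le).lt_of_ne fun hzero => ?_
  -- if it vanishes at `s`, it vanishes on `[t₀, s]`, and `G(u) v = 0` there
  have hGu : ∀ u, t₀ ≤ u → u ≤ s → ((w u)⁻¹ • ∑ l, (u ^ d l) • S l) *ᵥ v = 0 := by
    intro u hu hus
    have hu0 : 0 < u := ht₀.trans_le hu
    -- `vᵀG(u)v ≤ vᵀG(s)v = 0`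
    have hle : v ⬝ᵥ (((w u)⁻¹ • ∑ l, (u ^ d l) • S l) *ᵥ v)
        ≤ v ⬝ᵥ (((w s)⁻¹ • ∑ l, (s ^ d l) • S l) *ᵥ v) := by
      have h := (hmono u s hu0 hus).dotProduct_mulVec_nonneg v
      rw [star_trivial, Matrix.sub_mulVec, dotProduct_sub] at h
      linarith
    have hformu : v ⬝ᵥ (((w u)⁻¹ • ∑ l, (u ^ d l) • S l) *ᵥ v) = 0 :=
      le_antisymm (by rw [← hzero] at hle; exact hle) (hform_nonneg u hu)
    -- the PSD difference `G(u) − G(t₀)` has zero form at `v`, hence kills `v`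
    have h := (hmono t₀ u ht₀ hu).dotProduct_mulVec_zero_iff v
    rw [star_trivial, Matrix.sub_mulVec, dotProduct_sub, hGv, dotProduct_zero, sub_zero] at h
    have h2 := h.1 hformu
    rwa [sub_zero] at h2
  -- hence `F(u) v = 0` and `det F(u) = 0` on `[t₀, s]`
  have hdet' : ∀ u, t₀ ≤ u → u ≤ s → (∑ l, (u ^ d l) • S l).det = 0 := by
    intro u hu hus
    have hu0 : 0 < u := ht₀.trans_le hu
    refine Matrix.exists_mulVec_eq_zero_iff.1 ⟨v, hv, ?_⟩
    have h := hGu u hu hus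
    rw [Matrix.smul_mulVec] at h
    exact (smul_eq_zero.1 h).resolve_left (inv_ne_zero (hw u hu0).ne')
  refine hdet (Polynomial.eq_zero_of_infinite_isRoot _ ((Set.Ioo_infinite hs).mono ?_))
  intro u hu
  have hu' : t₀ < u ∧ u < s := hu
  show (Matrix.det (∑ l, ((Polynomial.X : Polynomial ℝ) ^ d l) •
      (S l).map Polynomial.C)).IsRoot u
  rw [Polynomial.IsRoot, ChainSector.eval_det_pencil d S u, hdet' u hu'.1.le hu'.2.le]

/-- **ENGINE: a positively normalisable Loewner-monotone pencil has at most `card ι` positive zeros.**  Let `Sₗ` be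
real symmetric and suppose some weight `w`, positive on `(0,∞)`, makes `u ↦ w(u)⁻¹ • ∑ₗ u^{dₗ} Sₗ` Loewner
non-decreasing on `(0,∞)`.  Then `det (∑ₗ X^{dₗ} Sₗ)` has at most `card ι` distinct positive zeros.  (No strictness
hypothesis: `kernelData` + the tree's inertia chain `stub_inertiaChain`.)  The tree's one-alternation rule
(`w = x^e`) and Loewner-chain sector (`w = ∑_{l ≥ p} x^{dₗ}`) are the instances of record. [folklore] -/
theorem posRoots_le_of_normalisation (ι : Type) [Fintype ι] [DecidableEq ι] (d : Fin K → ℕ)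
    (S : Fin K → Matrix ι ι ℝ) (hS : ∀ l, (S l).IsSymm) (w : ℝ → ℝ) (hw : ∀ u, 0 < u → 0 < w u)
    (hmono : ∀ s t : ℝ, 0 < s → s ≤ t →
      (((w t)⁻¹ • ∑ l, (t ^ d l) • S l) - ((w s)⁻¹ • ∑ l, (s ^ d l) • S l)).PosSemidef) :
    ((Matrix.det (∑ l, ((Polynomial.X : Polynomial ℝ) ^ d l) • (S l).map Polynomial.C)
        ).roots.toFinset.filter (fun t => 0 < t)).card ≤ Fintype.card ι := by
  set P := Matrix.det (∑ l, ((Polynomial.X : Polynomial ℝ) ^ d l) • (S l).map Polynomial.C)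
    with hPdef
  by_cases hdet : P = 0
  · simp [hdet]
  set R := P.roots.toFinset.filter (fun t => 0 < t) with hR
  let τ : Fin R.card ↪o ℝ := R.orderEmbOfFin rfl
  have hτmem : ∀ j, τ j ∈ R := fun j => R.orderEmbOfFin_mem rfl j
  have hτpos : ∀ j, 0 < τ j := fun j => (Finset.mem_filter.1 (hτmem j)).2
  have hτroot : ∀ j, P.IsRoot (τ j) := fun j => by
    have h1 := (Finset.mem_filter.1 (hτmem j)).1
    rw [Multiset.mem_toFinset] at h1
    exact (Polynomial.mem_roots hdet).1 h1
  let G : ℝ → Matrix ι ι ℝ := fun u => (w u)⁻¹ • ∑ l, (u ^ d l) • S l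
  have hdata : ∀ j, ∃ v : ι → ℝ, v ≠ 0 ∧ G (τ j) *ᵥ v = 0 ∧
      ∀ s : ℝ, τ j < s → 0 < v ⬝ᵥ (G s *ᵥ v) :=
    fun j => kernelData d S w hw hmono hdet (τ j) (hτpos j) (hτroot j)
  choose v _hv0 hker hpos using hdata
  exact stub_inertiaChain ι G (fun u => smul_family_isSymm d S hS _ u)
    (fun s t hs hst => hmono s t hs hst) R.card τ τ.strictMono hτpos v hker hpos

/-! ## §2 The three-block key inequality -/

/-- Expansion of the weighted skew form:
`w(s)·f(t) − w(t)·f(s) = ∑_{l' ∈ A} ∑ₗ a_{l'}·(s^{d l'} t^{d l} − t^{d l'} s^{d l})·qₗ`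
for `f(u) = ∑ₗ u^{dₗ} qₗ` and `w(u) = ∑_{l' ∈ A} a_{l'} u^{d l'}`. [folklore] -/
theorem skewForm_expand₃ (d : Fin K → ℕ) (a q : Fin K → ℝ) (A : Finset (Fin K)) (s t : ℝ) :
    (∑ l' ∈ A, a l' * s ^ d l') * (∑ l, t ^ d l * q l) - (∑ l' ∈ A, a l' * t ^ d l') * (∑ l, s ^ d l * q l)
      = ∑ l' ∈ A, ∑ l, a l' * (s ^ d l' * t ^ d l - t ^ d l' * s ^ d l) * q l := by
  rw [Finset.sum_mul_sum, Finset.sum_mul_sum, ← Finset.sum_sub_distrib]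
  refine Finset.sum_congr rfl fun l' _ => ?_
  rw [← Finset.sum_sub_distrib]
  refine Finset.sum_congr rfl fun l _ => ?_
  ring

/-- Weighted pairing on the core block: twice `∑_{i,j ∈ A} aᵢ·w(j,i)·qⱼ` is `∑_{i,j ∈ A} w(j,i)·(aᵢqⱼ − aⱼqᵢ)`. [folklore] -/
theorem core_pairing (d : Fin K → ℕ) (a q : Fin K → ℝ) (A : Finset (Fin K)) (s t : ℝ) :
    2 * (∑ i ∈ A, ∑ j ∈ A, a i * (s ^ d i * t ^ d j - t ^ d i * s ^ d j) * q j)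
      = ∑ i ∈ A, ∑ j ∈ A, (s ^ d i * t ^ d j - t ^ d i * s ^ d j) * (a i * q j - a j * q i) := by
  rw [two_mul]
  nth_rewrite 2 [Finset.sum_comm]
  rw [← Finset.sum_add_distrib]
  refine Finset.sum_congr rfl fun i _ => ?_
  rw [← Finset.sum_add_distrib]
  refine Finset.sum_congr rfl fun j _ => ?_
  ring

/-- Three-way split of a sum over `Fin K` along the blocks `l < p`, `p ≤ l ≤ r`, `r < l`. [folklore] -/
theorem sum_split₃ (p r : Fin K) (g : Fin K → ℝ) : ∑ l, g l = ∑ l ∈ univ.filter (fun l => ¬ p ≤ l), g l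
      + ∑ l ∈ univ.filter (fun l => p ≤ l ∧ l ≤ r), g l
      + ∑ l ∈ (univ.filter (fun l => p ≤ l)).filter (fun l => ¬ l ≤ r), g l := by
  rw [← Finset.sum_filter_add_sum_filter_not univ (fun l : Fin K => p ≤ l),
    ← Finset.sum_filter_add_sum_filter_not (univ.filter (fun l : Fin K => p ≤ l)) (fun l => l ≤ r),
    Finset.filter_filter]
  ring

/-- **Three-block key inequality.**  Exponents strictly increasing; blocks `l < p` (head), `p ≤ l ≤ r` (core),
`r < l` (tail); weights `aₗ > 0` on the core; scalars with `qₗ ≤ 0` on the head, `aᵢqⱼ − aⱼqᵢ ≥ 0` for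
`p ≤ i ≤ j ≤ r`, `qₗ ≥ 0` on the tail.  Then for `0 < s ≤ t`, `w(s)f(t) − w(t)f(s) ≥ 0` with
`w(u) = ∑_{core} aₗu^{dₗ}`, `f(u) = ∑ₗ u^{dₗ}qₗ`. [folklore] -/
theorem key₃_nonneg (d : Fin K → ℕ) (hd : StrictMono d) (p r : Fin K) (a q : Fin K → ℝ)
    (ha : ∀ l, p ≤ l → l ≤ r → 0 < a l) (hhead : ∀ l, l < p → q l ≤ 0)
    (hcore : ∀ i j, p ≤ i → i ≤ j → j ≤ r → 0 ≤ a i * q j - a j * q i) (htail : ∀ l, r < l → 0 ≤ q l)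
    {s t : ℝ} (hs : 0 < s) (hst : s ≤ t) :
    0 ≤ (∑ l' ∈ univ.filter (fun l' => p ≤ l' ∧ l' ≤ r), a l' * s ^ d l') * (∑ l, t ^ d l * q l)
        - (∑ l' ∈ univ.filter (fun l' => p ≤ l' ∧ l' ≤ r), a l' * t ^ d l') * (∑ l, s ^ d l * q l) := by
  set A := univ.filter (fun l' : Fin K => p ≤ l' ∧ l' ≤ r) with hA
  have hmemA : ∀ {l}, l ∈ A → p ≤ l ∧ l ≤ r := fun hl => (Finset.mem_filter.1 hl).2
  rw [skewForm_expand₃]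
  simp_rw [sum_split₃ p r]
  rw [Finset.sum_add_distrib, Finset.sum_add_distrib]
  refine add_nonneg (add_nonneg ?_ ?_) ?_
  · -- head × core
    refine Finset.sum_nonneg fun l' hl' => Finset.sum_nonneg fun l hl => ?_
    have hlp : l < p := not_le.1 (Finset.mem_filter.1 hl).2
    have hw : s ^ d l' * t ^ d l - t ^ d l' * s ^ d l ≤ 0 := by
      have := ChainSector.skew_nonneg hs.le hst (hd.monotone (hlp.le.trans (hmemA hl').1))
      linarith
    have h1 : a l' * (s ^ d l' * t ^ d l - t ^ d l' * s ^ d l) ≤ 0 :=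
      mul_nonpos_of_nonneg_of_nonpos (ha l' (hmemA hl').1 (hmemA hl').2).le hw
    exact mul_nonneg_of_nonpos_of_nonpos h1 (hhead l hlp)
  · -- core × core: pairing
    have h2 := core_pairing d a q A s t
    have hnn : 0 ≤ ∑ i ∈ A, ∑ j ∈ A, (s ^ d i * t ^ d j - t ^ d i * s ^ d j) * (a i * q j - a j * q i) := by
      refine Finset.sum_nonneg fun i hi => Finset.sum_nonneg fun j hj => ?_
      rcases le_total i j with hij | hji
      · exact mul_nonneg (ChainSector.skew_nonneg hs.le hst (hd.monotone hij))
          (hcore i j (hmemA hi).1 hij (hmemA hj).2)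
      · have hw : s ^ d i * t ^ d j - t ^ d i * s ^ d j ≤ 0 := by
          have := ChainSector.skew_nonneg hs.le hst (hd.monotone hji)
          linarith
        have hc : a i * q j - a j * q i ≤ 0 := by
          have := hcore j i (hmemA hj).1 hji (hmemA hi).2
          linarith
        exact mul_nonneg_of_nonpos_of_nonpos hw hc
    have e : ∑ l' ∈ A, ∑ l ∈ A, a l' * (s ^ d l' * t ^ d l - t ^ d l' * s ^ d l) * q l
        = ∑ i ∈ A, ∑ j ∈ A, a i * (s ^ d i * t ^ d j - t ^ d i * s ^ d j) * q j := rfl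
    rw [e]
    linarith
  · -- tail × core
    refine Finset.sum_nonneg fun l' hl' => Finset.sum_nonneg fun l hl => ?_
    have hrl : r < l := not_le.1 (Finset.mem_filter.1 hl).2
    have hw : 0 ≤ s ^ d l' * t ^ d l - t ^ d l' * s ^ d l :=
      ChainSector.skew_nonneg hs.le hst (hd.monotone ((hmemA hl').2.trans hrl.le))
    exact mul_nonneg (mul_nonneg (ha l' (hmemA hl').1 (hmemA hl').2).le hw) (htail l hrl)

/-! ## §3 Loewner monotonicity of `F/w` for the three-block family -/

/-- The core weight `w(u) = ∑_{p ≤ l ≤ r} aₗu^{dₗ}` is positive for `u > 0` (`p ≤ r`, `aₗ > 0` on the core).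
[folklore] -/
theorem coreWeight_pos (d : Fin K → ℕ) (p r : Fin K) (hpr : p ≤ r) (a : Fin K → ℝ)
    (ha : ∀ l, p ≤ l → l ≤ r → 0 < a l) {u : ℝ} (hu : 0 < u) :
    0 < ∑ l' ∈ univ.filter (fun l' => p ≤ l' ∧ l' ≤ r), a l' * u ^ d l' := by
  have hpA : p ∈ univ.filter (fun l' : Fin K => p ≤ l' ∧ l' ≤ r) :=
    Finset.mem_filter.2 ⟨Finset.mem_univ _, le_rfl, hpr⟩
  refine lt_of_lt_of_le (mul_pos (ha p le_rfl hpr) (pow_pos hu _))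
    (Finset.single_le_sum (f := fun l' => a l' * u ^ d l') (fun l' hl' => ?_) hpA)
  have h := (Finset.mem_filter.1 hl').2
  exact (mul_pos (ha l' h.1 h.2) (pow_pos hu _)).le

/-- **Loewner monotonicity for the three-block family**: `u ↦ w(u)⁻¹ • F(u)` is Loewner non-decreasing on `(0,∞)`.
[folklore] -/
theorem family_mono₃ (d : Fin K → ℕ) (hd : StrictMono d) (S : Fin K → Matrix ι ι ℝ) (hS : ∀ l, (S l).IsSymm)
    (p r : Fin K) (hpr : p ≤ r) (a : Fin K → ℝ) (ha : ∀ l, p ≤ l → l ≤ r → 0 < a l)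
    (hhead : ∀ l, l < p → (-S l).PosSemidef)
    (hcore : ∀ i j, p ≤ i → i ≤ j → j ≤ r → (a i • S j - a j • S i).PosSemidef)
    (htail : ∀ l, r < l → (S l).PosSemidef) (s t : ℝ) (hs : 0 < s) (hst : s ≤ t) :
    ((((∑ l' ∈ univ.filter (fun l' => p ≤ l' ∧ l' ≤ r), a l' * t ^ d l')⁻¹ • ∑ l, (t ^ d l) • S l))
      - (((∑ l' ∈ univ.filter (fun l' => p ≤ l' ∧ l' ≤ r), a l' * s ^ d l')⁻¹
          • ∑ l, (s ^ d l) • S l))).PosSemidef := by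
  refine Matrix.PosSemidef.of_dotProduct_mulVec_nonneg ?_ fun v => ?_
  · have h : ((((∑ l' ∈ univ.filter (fun l' => p ≤ l' ∧ l' ≤ r), a l' * t ^ d l')⁻¹
          • ∑ l, (t ^ d l) • S l))
        - (((∑ l' ∈ univ.filter (fun l' => p ≤ l' ∧ l' ≤ r), a l' * s ^ d l')⁻¹
          • ∑ l, (s ^ d l) • S l))).IsSymm := by
      unfold Matrix.IsSymm
      rw [Matrix.transpose_sub, (smul_family_isSymm d S hS _ t).eq, (smul_family_isSymm d S hS _ s).eq]
    exact Matrix.isHermitian_iff_isSymm.2 h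
  · rw [star_trivial, Matrix.sub_mulVec, dotProduct_sub, quadForm_smul_family, quadForm_smul_family, sub_nonneg]
    set q : Fin K → ℝ := fun l => v ⬝ᵥ (S l *ᵥ v) with hq
    have hheadq : ∀ l, l < p → q l ≤ 0 := by
      intro l hl
      have h := (hhead l hl).dotProduct_mulVec_nonneg v
      rw [star_trivial, Matrix.neg_mulVec, dotProduct_neg] at h
      simp only [hq]
      linarith
    have hcoreq : ∀ i j, p ≤ i → i ≤ j → j ≤ r → 0 ≤ a i * q j - a j * q i := by
      intro i j hpi hij hjr
      have h := (hcore i j hpi hij hjr).dotProduct_mulVec_nonneg v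
      rw [star_trivial, Matrix.sub_mulVec, dotProduct_sub, Matrix.smul_mulVec, Matrix.smul_mulVec,
        dotProduct_smul, dotProduct_smul, smul_eq_mul, smul_eq_mul] at h
      simpa only [hq] using h
    have htailq : ∀ l, r < l → 0 ≤ q l := by
      intro l hl
      have h := (htail l hl).dotProduct_mulVec_nonneg v
      rw [star_trivial] at h
      simpa only [hq] using h
    have hkey := key₃_nonneg d hd p r a q ha hheadq hcoreq htailq hs hst
    have hws := coreWeight_pos d p r hpr a ha hs
    have hwt := coreWeight_pos d p r hpr a ha (hs.trans_le hst)
    have e1 : ∑ l, t ^ d l * q l = ∑ l, t ^ d l * (v ⬝ᵥ (S l *ᵥ v)) := rfl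
    have e2 : ∑ l, s ^ d l * q l = ∑ l, s ^ d l * (v ⬝ᵥ (S l *ᵥ v)) := rfl
    rw [← e1, ← e2, inv_mul_eq_div, inv_mul_eq_div, div_le_div_iff₀ hws hwt]
    linarith

end LoewnerSector

/-! ## §4 The three-block Loewner sector -/

/-- **THE THREE-BLOCK LOEWNER SECTOR, K-free.**  Real symmetric letters `Sₗ` at strictly increasing exponents
`dₗ` (`l < K`); indices `p ≤ r`; positive scalars `aₗ` on the core `p ≤ l ≤ r`.  If `Sₗ ⪯ 0` for `l < p` (head),
`aᵢ·Sⱼ − aⱼ·Sᵢ ⪰ 0` for `p ≤ i ≤ j ≤ r` (the rescaled core letters `Sₗ/aₗ` form a Loewner chain; the letters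
themselves are arbitrary) and `Sₗ ⪰ 0` for `l > r` (tail), then `det (∑ₗ X^{dₗ} Sₗ)` has at most `card ι` distinct
positive zeros, for any number of terms.  Contains `oneAlternation_mirror` with one pivot letter (`p = r`),
`chainSector` (`r = K − 1`, `a ≡ 1`) and the scaled chain (`p = 0`, `r = K − 1`); tight (diagonal chains); at
`card ι = 1` it is Descartes' rule for at most one sign change. [folklore] -/
theorem loewnerSector (ι : Type) [Fintype ι] [DecidableEq ι] (K : ℕ) (d : Fin K → ℕ) (hd : StrictMono d)
    (S : Fin K → Matrix ι ι ℝ) (hS : ∀ l, (S l).IsSymm) (p r : Fin K) (hpr : p ≤ r) (a : Fin K → ℝ)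
    (ha : ∀ l, p ≤ l → l ≤ r → 0 < a l) (hhead : ∀ l, l < p → (-S l).PosSemidef)
    (hcore : ∀ i j, p ≤ i → i ≤ j → j ≤ r → (a i • S j - a j • S i).PosSemidef)
    (htail : ∀ l, r < l → (S l).PosSemidef) :
    ((Matrix.det (∑ l, ((Polynomial.X : Polynomial ℝ) ^ d l) • (S l).map Polynomial.C)
        ).roots.toFinset.filter (fun t => 0 < t)).card ≤ Fintype.card ι :=
  LoewnerSector.posRoots_le_of_normalisation ι d S hS
    (fun u => ∑ l' ∈ univ.filter (fun l' => p ≤ l' ∧ l' ≤ r), a l' * u ^ d l')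
    (fun _ hu => LoewnerSector.coreWeight_pos d p r hpr a ha hu)
    (fun s t hs hst => LoewnerSector.family_mono₃ d hd S hS p r hpr a ha hhead hcore htail s t hs hst)

/-- **The scaled Loewner chain** (`p = 0`, `r = K − 1`): if for some positive scalars `aₗ` the rescaled letters
`Sₗ/aₗ` (at strictly increasing exponents) form a Loewner chain — `aᵢ·Sⱼ − aⱼ·Sᵢ ⪰ 0` for `i ≤ j` — then
`det (∑ₗ X^{dₗ} Sₗ)` has at most `card ι` distinct positive zeros.  At `card ι = 1` this is exactly «at most one sign
change». [folklore] -/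
theorem scaledChain_posRoots_le (ι : Type) [Fintype ι] [DecidableEq ι] (K : ℕ) (d : Fin K → ℕ)
    (hd : StrictMono d) (S : Fin K → Matrix ι ι ℝ) (hS : ∀ l, (S l).IsSymm) (a : Fin K → ℝ)
    (ha : ∀ l, 0 < a l) (hchain : ∀ i j, i ≤ j → (a i • S j - a j • S i).PosSemidef) :
    ((Matrix.det (∑ l, ((Polynomial.X : Polynomial ℝ) ^ d l) • (S l).map Polynomial.C)
        ).roots.toFinset.filter (fun t => 0 < t)).card ≤ Fintype.card ι := by
  rcases Nat.eq_zero_or_pos K with hK | hK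
  · subst hK
    have h0 : (∑ l : Fin 0, ((Polynomial.X : Polynomial ℝ) ^ d l) • (S l).map Polynomial.C) = 0 :=
      Finset.sum_of_isEmpty _
    rw [h0]
    rcases isEmpty_or_nonempty ι with hι | hι
    · rw [Matrix.det_isEmpty, Polynomial.roots_one]
      simp
    · rw [Matrix.det_zero, Polynomial.roots_zero]
      simp
  · exact loewnerSector ι K d hd S hS ⟨0, hK⟩ ⟨K - 1, Nat.sub_lt hK one_pos⟩ (Fin.mk_le_mk.2 (Nat.zero_le _))
      a (fun l _ _ => ha l) (fun l hl => absurd (Fin.lt_def.1 hl) (Nat.not_lt_zero _))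
      (fun i j _ hij _ => hchain i j hij)
      (fun l hl => absurd (Fin.lt_def.1 hl) (not_lt.2 (Nat.le_sub_one_of_lt l.isLt)))

/-- **Real zeros of a two-way three-block word**: if `F(X)` and `F(−X) = ∑ₗ X^{dₗ}((−1)^{dₗ}Sₗ)` (real symmetric
`m × m` letters, `K` terms, strictly increasing exponents) are both three-block Loewner words, `det F` has at most
`2m + 1` distinct real zeros (tree `stub_negRoots`). [folklore] -/
theorem loewnerWord_realRoots_le (K m : ℕ) (d : Fin K → ℕ) (hd : StrictMono d)
    (S : Fin K → Matrix (Fin m) (Fin m) ℝ) (hS : ∀ l, (S l).IsSymm)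
    (p r : Fin K) (hpr : p ≤ r) (a : Fin K → ℝ) (ha : ∀ l, p ≤ l → l ≤ r → 0 < a l)
    (hhead : ∀ l, l < p → (-S l).PosSemidef)
    (hcore : ∀ i j, p ≤ i → i ≤ j → j ≤ r → (a i • S j - a j • S i).PosSemidef)
    (htail : ∀ l, r < l → (S l).PosSemidef)
    (p' r' : Fin K) (hpr' : p' ≤ r') (a' : Fin K → ℝ) (ha' : ∀ l, p' ≤ l → l ≤ r' → 0 < a' l)
    (hhead' : ∀ l, l < p' → (-(((-1 : ℝ) ^ d l) • S l)).PosSemidef)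
    (hcore' : ∀ i j, p' ≤ i → i ≤ j → j ≤ r' →
      (a' i • (((-1 : ℝ) ^ d j) • S j) - a' j • (((-1 : ℝ) ^ d i) • S i)).PosSemidef)
    (htail' : ∀ l, r' < l → (((-1 : ℝ) ^ d l) • S l).PosSemidef) :
    (Matrix.det (∑ l, ((Polynomial.X : Polynomial ℝ) ^ d l) • (S l).map Polynomial.C)
      ).roots.toFinset.card ≤ 2 * m + 1 := by
  have h1 := loewnerSector (Fin m) K d hd S hS p r hpr a ha hhead hcore htail
  have h2 := loewnerSector (Fin m) K d hd (fun l => ((-1 : ℝ) ^ d l) • S l) (fun l => (hS l).smul _)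
    p' r' hpr' a' ha' hhead' hcore' htail'
  have h3 := stub_negRoots K m d S
  rw [Fintype.card_fin] at h1 h2; omega

/-- **The crux's inequality on two-way three-block Loewner words, at every admissible size.**  For all `c, q` there is
`K₀` such that for all `K ≥ K₀`, all `m ≤ 2^((⌊log₂K⌋+c)^c)`, all strictly increasing exponents and all real
symmetric letters for which `F(X)` and `F(−X)` are three-block Loewner words (data `p ≤ r`, `a`; `p' ≤ r'`, `a'`),
the number `Z` of distinct real zeros of `det (∑ₗ X^{dₗ} Sₗ)` satisfies `Z^q ≤ 2^(K⌊log₂K⌋)` — `MatrixDescartes`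
restricted to this format family, fat formats included.  Nothing is claimed outside the family. [folklore] -/
theorem loewnerSector_mdr (c q : ℕ) : ∃ K₀ : ℕ, ∀ K m : ℕ, K₀ ≤ K →
    m ≤ 2 ^ ((Nat.log 2 K + c) ^ c) → ∀ (d : Fin K → ℕ), StrictMono d →
      ∀ (S : Fin K → Matrix (Fin m) (Fin m) ℝ), (∀ l, (S l).IsSymm) →
      ∀ (p r : Fin K), p ≤ r → ∀ (a : Fin K → ℝ), (∀ l, p ≤ l → l ≤ r → 0 < a l) →
      (∀ l, l < p → (-S l).PosSemidef) →
      (∀ i j, p ≤ i → i ≤ j → j ≤ r → (a i • S j - a j • S i).PosSemidef) →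
      (∀ l, r < l → (S l).PosSemidef) →
      ∀ (p' r' : Fin K), p' ≤ r' → ∀ (a' : Fin K → ℝ), (∀ l, p' ≤ l → l ≤ r' → 0 < a' l) →
      (∀ l, l < p' → (-(((-1 : ℝ) ^ d l) • S l)).PosSemidef) →
      (∀ i j, p' ≤ i → i ≤ j → j ≤ r' →
        (a' i • (((-1 : ℝ) ^ d j) • S j) - a' j • (((-1 : ℝ) ^ d i) • S i)).PosSemidef) →
      (∀ l, r' < l → (((-1 : ℝ) ^ d l) • S l).PosSemidef) →
      (Matrix.det (∑ l, ((Polynomial.X : Polynomial ℝ) ^ d l) • (S l).map Polynomial.C)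
        ).roots.toFinset.card ^ q ≤ 2 ^ (K * Nat.log 2 K) := by
  obtain ⟨K₁, hK₁⟩ := linearCount_absorbed c q
  exact ⟨K₁, fun K m hK hm d hd S hS p r hpr a ha hhead hcore htail p' r' hpr' a' ha' hhead' hcore' htail' =>
    hK₁ K m _ hK hm (loewnerWord_realRoots_le K m d hd S hS p r hpr a ha hhead hcore htail p' r' hpr' a' ha'
      hhead' hcore' htail')⟩

end Summit.ValiantsHypothesis.ValiantsHypothesis.Theorems.LacunarySymmetroidMatrixDescartes
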